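import Literature.AlgebraicGeometry.HodgeTheory.RelativeResidueForms
import Literature.Geometry.Kaehler.VerticallyHolomorphicGluing
import Literature.Geometry.Kaehler.DeformationEquivalence
import HarnessLib

/-!
# Gluing the relative Griffiths residue forms of a family of hypersurfaces
# (Griffiths 1969 §8; Voisin II §6.1; Voisin I §10.2.2)

Family `hodge`, layer `Literature/AlgebraicGeometry/HodgeTheory`. PROOF FILE (theorems only; no
definition, no named fact). Written by the prover seat `hodge-nonav-prover-Bx` (g14, cell `hodge-nonav`)
as brick **FF3** of prover-Ax's programme «GRIFFITHS-SURFACES / B4 RELATIVE RESIDUES» (route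
`HodgeConjecture/CyclicUnitaryPowers`, `--supports stmt-HodgeConjecture-19544`): the relative residue
forms `y ↦ Res(PΩ/F_y)` of `RelativeResidueForms` (brick F-B), computed in the admissible charts
`(i, j)` of the total space, are GLUED by a partition of unity (brick F-A, `VerticallyHolomorphicGluing`)
into ONE smooth `m`-form `Ξ = ∑ p, χ p • Ξ_p` on the total space `T`, with the three properties the
period-holomorphy argument (`PeriodIntegralHolomorphicVertical`, brick B1 / F-C) consumes.

Abstract data (as in F-B): `T` a complex manifold charted on `E`, `ψ : T → ℙ ℂ ℂ^{m+2}` continuous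
with holomorphic affine coordinates, the equations `F_y = Σ_s c_s(y) • G_s` with holomorphic
coefficients `c_s : T → ℂ`, a numerator `P`; index pairs `p = (i, j)`; the local forms are ANY forms
`Ξ p` with `Ξ p y = (residueFormula ψ F_y P i j y)|_ℝ` (hypothesis `hΞ`), the supports of the `χ p` lie
in sets `U p` of `(i, j)`-ADMISSIBLE points (`y ∈ Tᵢ`, `∂_jF_y(Z̃ᵢ y) ≠ 0`; hypothesis `hUadm`).

* `exists_partition_adapted_relResidue` — on a neighbourhood of a compact `K` covered by admissible
  pairs there are an open `G' ⊇ K` and a smooth partition `χ` subordinate to the admissible sets with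
  `Σ χ = 1` on `G'` (F-A (4) on the compact closure of an open between `K` and the union);
* `isSmoothForm_sum_smul_relResidue` — **`Ξ` is smooth** (F-A (1); the chart germs are those of
  `exists_analyticGerm_residueFormula_family`, F-B);
* `mextDeriv_sum_smul_relResidue_cons_I_smul` — **the vertical `(1,0)`-condition of `dΞ`** on `G'`
  for ANY verticality predicate on which the local forms agree (F-A (3));
* `pullback_relResidue_eq_residueForm`, `relResidue_agree_on_fibre` — **agreement on a fibre**: along a
  holomorphic `ι : X → T` on which the equation is constant `= F₀` (homogeneous of degree `d ≥ m + 2`,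
  non-singular cone, `ψ ∘ ι` into `V(F₀)`, `deg P = d − m − 2`), every local form pulls back, at an
  admissible point, to THE residue form `residueForm (ψ ∘ ι) F₀ P` of `X` (F-B
  `pullback_eventuallyEq_residueForm`); hence any two local forms agree on tuples of vectors `dι(u)`;
* `relResidue_agree_of_fibreEmbeddings`, `mextDeriv_sum_smul_relResidue_cons_I_smul_of_fibreEmbeddings`
  — **the agreement hypothesis DISCHARGED** for a family `π : T → B` with fibre identifications
  `ι b : X b → T` (`IsFibreEmbedding`, `b ∈ O`) and fibrewise constant equations `F_{ι b x} = F_b`, for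
  the verticality predicate «`u = dι_{π y}(u')` on the fibre through `y`»; so `dΞ` satisfies the vertical
  `(1,0)`-condition on `G' ∩ π⁻¹ O` for it (the kernel predicate `dπ_y u = 0` of F-C reduces to it by
  F-C's rank count `ker dπ ⊆ im dι`);
* `pullback_sum_smul_relResidue_eq_residueForm` — **`ι^* Ξ = residueForm (ψ ∘ ι) F₀ P` on `X`** at the
  points `x` with `ι x ∈ G'` (the `χ`-weighted average of equal admissible formulas): the glued form
  RESTRICTS to the Griffiths residue form `Res(PΩ/F_b)` of each fibre.

Honest scope: bookkeeping; nothing here says HC or any rung is proved.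

## References

* [Griffiths1969] P. Griffiths, On the periods of certain rational integrals I, Ann. of Math. 90
  (1969), §8 (the residues and their periods vary holomorphically with the hypersurface).
* [VoisinHodgeII2003] C. Voisin, Hodge Theory and Complex Algebraic Geometry II, CUP 2003, §6.1.1,
  §6.1.3 (Griffiths residues, local formula `± P dx_K/(∂F/∂x_j)`).
* [VoisinHodgeI2002] C. Voisin, Hodge Theory and Complex Algebraic Geometry I, CUP 2002, §9.1.1,
  §10.2.2 (proof of Thm. 10.9).
* [WarnerGTM94] F. Warner, Foundations of Differentiable Manifolds and Lie Groups, GTM 94 (1983),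
  1.11 (partitions of unity), 2.22 (pull-back).
-/

noncomputable section

open scoped Manifold ContDiff Topology LinearAlgebra.Projectivization
open Set Filter Complex Projectivization
open Literature.NumberTheory.Transcendental Literature.Geometry.Kaehler

namespace Literature.AlgebraicGeometry.HodgeTheory

-- The identification `TangentSpace I x = E` is an abuse of definitional equality; as in the tree's
-- form files we let `isDefEq` unfold it.
set_option backward.isDefEq.respectTransparency false

section Glue

variable {m : ℕ} {E : Type*} [NormedAddCommGroup E] [NormedSpace ℂ E] [FiniteDimensional ℂ E]
  {T : Type*} [TopologicalSpace T] [ChartedSpace E T] [IsManifold 𝓘(ℂ, E) ω T]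
  [IsManifold 𝓘(ℝ, E) ∞ T]
  (ψ : T → ℙ ℂ (Fin (m + 2) → ℂ)) {σ : Type*} [Fintype σ] (G : σ → MvPolynomial (Fin (m + 2)) ℂ)
  (c : σ → T → ℂ) (P : MvPolynomial (Fin (m + 2)) ℂ)

/-! ### The chart germs of the local forms; smoothness and the `(1,0)`-condition of the glued form -/

/-- **The local relative residue forms are holomorphic in charts at their admissible points**
(F-B `exists_analyticGerm_residueFormula_family`, for every form `Ξ p` which IS, pointwise,
`(residueFormula ψ F_y P i j y)|_ℝ`, at every point of a set `U p` of `(i, j)`-admissible points).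
[cite: Griffiths1969, §8] [cite: VoisinHodgeII2003, §6.1.3] -/
theorem exists_analyticGerm_relResidue (hψ : Continuous ψ) (hhol : HasHolomorphicCoords E ψ)
    (hc : ∀ s, MDifferentiable 𝓘(ℂ, E) 𝓘(ℂ, ℂ) (c s))
    {Ξ : Fin (m + 2) × Fin (m + 2) → MForm 𝓘(ℝ, E) T ℂ m}
    (hΞ : ∀ p y, Ξ p y = (show E [⋀^Fin m]→L[ℝ] ℂ from
      (residueFormula ψ (∑ s, c s y • G s) P p.1 p.2 y).restrictScalars ℝ))
    {U : Fin (m + 2) × Fin (m + 2) → Set T}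
    (hUadm : ∀ p, ∀ y ∈ U p, y ∈ liftDomain ψ p.1 ∧
      MvPolynomial.eval (projLift ψ p.1 y) (MvPolynomial.pderiv p.2 (∑ s, c s y • G s)) ≠ 0)
    (p : Fin (m + 2) × Fin (m + 2)) (y : T) (hy : y ∈ U p) :
    ∃ g : E → E [⋀^Fin m]→L[ℂ] ℂ, AnalyticAt ℂ g (extChartAt 𝓘(ℝ, E) y y) ∧
      (Ξ p).inChart y =ᶠ[𝓝 (extChartAt 𝓘(ℝ, E) y y)] fun z ↦ (g z).restrictScalars ℝ :=
  exists_analyticGerm_residueFormula_family ψ hψ hhol G hc P (hUadm p y hy).1 (hUadm p y hy).2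
    (Eventually.of_forall fun y' ↦ hΞ p y')

/-- **The glued relative residue form `∑ p, χ p • Ξ p` is smooth** (F-A `isSmoothForm_sum_smul`), for
smooth `χ p` supported in the admissible sets `U p`. [cite: Griffiths1969, §8] [cite: WarnerGTM94, 1.11] -/
theorem isSmoothForm_sum_smul_relResidue (hψ : Continuous ψ) (hhol : HasHolomorphicCoords E ψ)
    (hc : ∀ s, MDifferentiable 𝓘(ℂ, E) 𝓘(ℂ, ℂ) (c s))
    {Ξ : Fin (m + 2) × Fin (m + 2) → MForm 𝓘(ℝ, E) T ℂ m}
    (hΞ : ∀ p y, Ξ p y = (show E [⋀^Fin m]→L[ℝ] ℂ from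
      (residueFormula ψ (∑ s, c s y • G s) P p.1 p.2 y).restrictScalars ℝ))
    {U : Fin (m + 2) × Fin (m + 2) → Set T}
    (hUadm : ∀ p, ∀ y ∈ U p, y ∈ liftDomain ψ p.1 ∧
      MvPolynomial.eval (projLift ψ p.1 y) (MvPolynomial.pderiv p.2 (∑ s, c s y • G s)) ≠ 0)
    {χ : Fin (m + 2) × Fin (m + 2) → T → ℝ} (hχ : ∀ p, ContMDiff 𝓘(ℝ, E) 𝓘(ℝ) ∞ (χ p))
    (hsupp : ∀ p, tsupport (χ p) ⊆ U p) :
    IsSmoothForm (∑ p, χ p • Ξ p) :=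
  isSmoothForm_sum_smul (exists_analyticGerm_relResidue ψ G c P hψ hhol hc hΞ hUadm) hχ hsupp

/-- **The vertical `(1,0)`-condition of the glued relative residue form** (F-A
`mextDeriv_sum_smul_cons_I_smul`): on an open `G'` with `Σ χ = 1`, for ANY verticality predicate
`Vert` on which the local forms agree at the points of `G'`, and every vertical tuple `w`,
`d(∑ χ p • Ξ p) y (i v, w) = i · d(∑ χ p • Ξ p) y (v, w)` — the hypothesis `hdΞ` of
`differentiableAt_complex_cintegral_wedge_pullback_family_of_vertical`.
[cite: VoisinHodgeI2002, §10.2.2 (proof of Thm. 10.9)] [cite: Griffiths1969, §8] -/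
theorem mextDeriv_sum_smul_relResidue_cons_I_smul (hψ : Continuous ψ) (hhol : HasHolomorphicCoords E ψ)
    (hc : ∀ s, MDifferentiable 𝓘(ℂ, E) 𝓘(ℂ, ℂ) (c s))
    {Ξ : Fin (m + 2) × Fin (m + 2) → MForm 𝓘(ℝ, E) T ℂ m}
    (hΞ : ∀ p y, Ξ p y = (show E [⋀^Fin m]→L[ℝ] ℂ from
      (residueFormula ψ (∑ s, c s y • G s) P p.1 p.2 y).restrictScalars ℝ))
    {U : Fin (m + 2) × Fin (m + 2) → Set T}
    (hUadm : ∀ p, ∀ y ∈ U p, y ∈ liftDomain ψ p.1 ∧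
      MvPolynomial.eval (projLift ψ p.1 y) (MvPolynomial.pderiv p.2 (∑ s, c s y • G s)) ≠ 0)
    {χ : Fin (m + 2) × Fin (m + 2) → T → ℝ} (hχ : ∀ p, ContMDiff 𝓘(ℝ, E) 𝓘(ℝ) ∞ (χ p))
    (hsupp : ∀ p, tsupport (χ p) ⊆ U p)
    (Vert : T → E → Prop) {G' : Set T} (hG' : IsOpen G') (hsum : ∀ y ∈ G', ∑ p, χ p y = 1)
    (hagree : ∀ p q, ∀ y ∈ G', y ∈ U p → y ∈ U q → ∀ w : Fin m → E, (∀ k, Vert y (w k)) →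
      Ξ p y w = Ξ q y w)
    {y : T} (hy : y ∈ G') (v : E) (w : Fin m → E) (hw : ∀ k, Vert y (w k)) :
    (show E [⋀^Fin (m + 1)]→L[ℝ] ℂ from mextDeriv (∑ p, χ p • Ξ p) y) (Fin.cons (I • v) w) =
      I * (show E [⋀^Fin (m + 1)]→L[ℝ] ℂ from mextDeriv (∑ p, χ p • Ξ p) y) (Fin.cons v w) :=
  mextDeriv_sum_smul_cons_I_smul (exists_analyticGerm_relResidue ψ G c P hψ hhol hc hΞ hUadm) hχ hsupp
    Vert hG' hsum hagree hy v w hw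

/-! ### Agreement of the local forms on a fibre -/

section Fibre

variable {EX : Type*} [NormedAddCommGroup EX] [NormedSpace ℂ EX]
  {X : Type*} [TopologicalSpace X] [ChartedSpace EX X]

omit [FiniteDimensional ℂ E] [IsManifold 𝓘(ℂ, E) ω T] [IsManifold 𝓘(ℝ, E) ∞ T] in
/-- **On a fibre every local relative residue form pulls back to THE residue form.** Let `ι : X → T`
be holomorphic with the equation constant along it, `F_{ι x} = F₀` (`F₀` homogeneous of degree
`d ≥ m + 2` with non-singular cone, `ψ ∘ ι` into `V(F₀)`, `deg P = d − m − 2`). Then at every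
`(i, j)`-admissible point `ι x`: `ι^*(Ξ (i,j)) x = residueForm (ψ ∘ ι) F₀ P x` (F-B
`pullback_eventuallyEq_residueForm` at the point). [cite: VoisinHodgeII2003, §6.1.1 and §6.1.3]
[cite: Griffiths1969, §8] -/
theorem pullback_relResidue_eq_residueForm (hψ : Continuous ψ) (hhol : HasHolomorphicCoords E ψ)
    {Ξ : Fin (m + 2) × Fin (m + 2) → MForm 𝓘(ℝ, E) T ℂ m}
    (hΞ : ∀ p y, Ξ p y = (show E [⋀^Fin m]→L[ℝ] ℂ from
      (residueFormula ψ (∑ s, c s y • G s) P p.1 p.2 y).restrictScalars ℝ))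
    {ι : X → T} (hιc : Continuous ι) (hιd : MDifferentiable 𝓘(ℂ, EX) 𝓘(ℂ, E) ι)
    {F₀ : MvPolynomial (Fin (m + 2)) ℂ} {d : ℕ} (hF₀ : F₀.IsHomogeneous d)
    (hjac : ∀ z : Fin (m + 2) → ℂ, z ≠ 0 → MvPolynomial.eval z F₀ = 0 →
      ∃ j, MvPolynomial.eval z (MvPolynomial.pderiv j F₀) ≠ 0)
    (hFι : ∀ x, (∑ s, c s (ι x) • G s) = F₀) (hrange : Set.range (ψ ∘ ι) ⊆ projZeroLocus {F₀})
    (hP : P.IsHomogeneous (d - (m + 2))) (hd : m + 2 ≤ d)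
    (p : Fin (m + 2) × Fin (m + 2)) {x : X} (hx : ι x ∈ liftDomain ψ p.1)
    (hj : MvPolynomial.eval (projLift ψ p.1 (ι x)) (MvPolynomial.pderiv p.2 F₀) ≠ 0) :
    (Ξ p).pullback 𝓘(ℝ, EX) ι x = residueForm (ψ ∘ ι) F₀ P x := by
  have hη : ∀ᶠ x' in 𝓝 x, Ξ p (ι x') =
      (show E [⋀^Fin m]→L[ℝ] ℂ from (residueFormula ψ F₀ P p.1 p.2 (ι x')).restrictScalars ℝ) :=
    Eventually.of_forall fun x' ↦ by rw [hΞ, hFι]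
  exact (pullback_eventuallyEq_residueForm ψ ι hψ hhol hF₀ hjac hP hd hιc hιd hrange hx hj hη).self_of_nhds

omit [FiniteDimensional ℂ E] [IsManifold 𝓘(ℂ, E) ω T] [IsManifold 𝓘(ℝ, E) ∞ T] in
/-- **Two local relative residue forms agree on the tangent vectors of a fibre**: with `ι`, `F₀` as in
`pullback_relResidue_eq_residueForm`, at a point `y = ι x` admissible for both `p` and `q`, and for
every tuple `u` of vectors of `X`: `Ξ p y (dι u) = Ξ q y (dι u)` (both are `residueForm (ψ ∘ ι) F₀ P x u`).
The agreement hypothesis `hagree` of the gluing, for vertical = tangent to the fibre.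
[cite: VoisinHodgeII2003, §6.1.1] [cite: Griffiths1969, §8] -/
theorem relResidue_agree_on_fibre (hψ : Continuous ψ) (hhol : HasHolomorphicCoords E ψ)
    {Ξ : Fin (m + 2) × Fin (m + 2) → MForm 𝓘(ℝ, E) T ℂ m}
    (hΞ : ∀ p y, Ξ p y = (show E [⋀^Fin m]→L[ℝ] ℂ from
      (residueFormula ψ (∑ s, c s y • G s) P p.1 p.2 y).restrictScalars ℝ))
    {ι : X → T} (hιc : Continuous ι) (hιd : MDifferentiable 𝓘(ℂ, EX) 𝓘(ℂ, E) ι)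
    {F₀ : MvPolynomial (Fin (m + 2)) ℂ} {d : ℕ} (hF₀ : F₀.IsHomogeneous d)
    (hjac : ∀ z : Fin (m + 2) → ℂ, z ≠ 0 → MvPolynomial.eval z F₀ = 0 →
      ∃ j, MvPolynomial.eval z (MvPolynomial.pderiv j F₀) ≠ 0)
    (hFι : ∀ x, (∑ s, c s (ι x) • G s) = F₀) (hrange : Set.range (ψ ∘ ι) ⊆ projZeroLocus {F₀})
    (hP : P.IsHomogeneous (d - (m + 2))) (hd : m + 2 ≤ d)
    (p q : Fin (m + 2) × Fin (m + 2)) {x : X} {y : T} (hxy : ι x = y)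
    (hp : y ∈ liftDomain ψ p.1 ∧
      MvPolynomial.eval (projLift ψ p.1 y) (MvPolynomial.pderiv p.2 (∑ s, c s y • G s)) ≠ 0)
    (hq : y ∈ liftDomain ψ q.1 ∧
      MvPolynomial.eval (projLift ψ q.1 y) (MvPolynomial.pderiv q.2 (∑ s, c s y • G s)) ≠ 0)
    (u : Fin m → EX) :
    Ξ p y (fun k ↦ (show E from mfderiv 𝓘(ℝ, EX) 𝓘(ℝ, E) ι x (u k))) =
      Ξ q y (fun k ↦ (show E from mfderiv 𝓘(ℝ, EX) 𝓘(ℝ, E) ι x (u k))) := by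
  subst hxy
  rw [hFι] at hp hq
  have hp' := pullback_relResidue_eq_residueForm ψ G c P hψ hhol hΞ hιc hιd hF₀ hjac hFι hrange hP hd
    p hp.1 hp.2
  have hq' := pullback_relResidue_eq_residueForm ψ G c P hψ hhol hΞ hιc hιd hF₀ hjac hFι hrange hP hd
    q hq.1 hq.2
  exact congrArg (fun A : EX [⋀^Fin m]→L[ℝ] ℂ ↦ A u) (hp'.trans hq'.symm)

omit [FiniteDimensional ℂ E] [IsManifold 𝓘(ℂ, E) ω T] [IsManifold 𝓘(ℝ, E) ∞ T] in
/-- **The glued form restricts to the residue form of the fibre**: with `ι`, `F₀` as in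
`pullback_relResidue_eq_residueForm` and the supports of the `χ p` inside the `p`-admissible sets, at
every `x` with `Σ_p χ p (ι x) = 1`: `ι^*(∑ p, χ p • Ξ p) x = residueForm (ψ ∘ ι) F₀ P x` (the
`χ`-weighted average of the admissible formulas, all equal to the residue form; the other `χ p` vanish
at `ι x`). So on each fibre the glued form IS `Res(PΩ/F_b)` (Griffiths 1969 §8; Voisin II §6.1.3).
[cite: Griffiths1969, §8] [cite: VoisinHodgeII2003, §6.1.3] -/
theorem pullback_sum_smul_relResidue_eq_residueForm (hψ : Continuous ψ) (hhol : HasHolomorphicCoords E ψ)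
    {Ξ : Fin (m + 2) × Fin (m + 2) → MForm 𝓘(ℝ, E) T ℂ m}
    (hΞ : ∀ p y, Ξ p y = (show E [⋀^Fin m]→L[ℝ] ℂ from
      (residueFormula ψ (∑ s, c s y • G s) P p.1 p.2 y).restrictScalars ℝ))
    {U : Fin (m + 2) × Fin (m + 2) → Set T}
    (hUadm : ∀ p, ∀ y ∈ U p, y ∈ liftDomain ψ p.1 ∧
      MvPolynomial.eval (projLift ψ p.1 y) (MvPolynomial.pderiv p.2 (∑ s, c s y • G s)) ≠ 0)
    {χ : Fin (m + 2) × Fin (m + 2) → T → ℝ} (hsupp : ∀ p, tsupport (χ p) ⊆ U p)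
    {ι : X → T} (hιc : Continuous ι) (hιd : MDifferentiable 𝓘(ℂ, EX) 𝓘(ℂ, E) ι)
    {F₀ : MvPolynomial (Fin (m + 2)) ℂ} {d : ℕ} (hF₀ : F₀.IsHomogeneous d)
    (hjac : ∀ z : Fin (m + 2) → ℂ, z ≠ 0 → MvPolynomial.eval z F₀ = 0 →
      ∃ j, MvPolynomial.eval z (MvPolynomial.pderiv j F₀) ≠ 0)
    (hFι : ∀ x, (∑ s, c s (ι x) • G s) = F₀) (hrange : Set.range (ψ ∘ ι) ⊆ projZeroLocus {F₀})
    (hP : P.IsHomogeneous (d - (m + 2))) (hd : m + 2 ≤ d)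
    {x : X} (hsum : ∑ p, χ p (ι x) = 1) :
    (∑ p, χ p • Ξ p).pullback 𝓘(ℝ, EX) ι x = residueForm (ψ ∘ ι) F₀ P x := by
  classical
  -- every summand pulls back to `χ p (ι x) • residueForm … x`
  have hterm : ∀ p, (χ p • Ξ p).pullback 𝓘(ℝ, EX) ι x = χ p (ι x) • residueForm (ψ ∘ ι) F₀ P x := by
    intro p
    by_cases hpx : ι x ∈ U p
    · have hadm := hUadm p (ι x) hpx
      rw [hFι] at hadm
      rw [← pullback_relResidue_eq_residueForm ψ G c P hψ hhol hΞ hιc hιd hF₀ hjac hFι hrange hP hd p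
        hadm.1 hadm.2]
      ext u
      simp only [MForm.pullback_apply]
      rfl
    · have h0 : χ p (ι x) = 0 :=
        (notMem_tsupport_iff_eventuallyEq.1 fun h ↦ hpx (hsupp p h)).self_of_nhds
      ext u
      simp only [MForm.pullback_apply, h0, zero_smul, ContinuousAlternatingMap.coe_zero, Pi.zero_apply]
      change (χ p (ι x) • Ξ p (ι x)) _ = 0
      rw [h0, zero_smul, ContinuousAlternatingMap.coe_zero, Pi.zero_apply]
  have hsum' : (∑ p, χ p • Ξ p).pullback 𝓘(ℝ, EX) ι x = ∑ p, (χ p • Ξ p).pullback 𝓘(ℝ, EX) ι x := by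
    ext u
    simp only [MForm.pullback_apply, Finset.sum_apply, ContinuousAlternatingMap.sum_apply]
  rw [hsum', Finset.sum_congr rfl fun p _ ↦ hterm p, ← Finset.sum_smul, hsum, one_smul]

end Fibre

/-! ### The agreement hypothesis discharged for a family with fibre identifications -/

section Family

variable {EX : Type*} [NormedAddCommGroup EX] [NormedSpace ℂ EX]
  {B : Type*} [TopologicalSpace B] (π : T → B)
  (Xf : B → Type*) [∀ b, TopologicalSpace (Xf b)] [∀ b, ChartedSpace EX (Xf b)] (ι : ∀ b, Xf b → T)

omit [FiniteDimensional ℂ E] [IsManifold 𝓘(ℂ, E) ω T] [IsManifold 𝓘(ℝ, E) ∞ T] [TopologicalSpace B] in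
/-- **The agreement hypothesis of the gluing, for a family with fibre identifications.** Data: a map
`π : T → B`, complex manifolds `X b` charted on `EX` with maps `ι b : X b → T` which, for `b` in a set
`O`, are fibre identifications (`IsFibreEmbedding`: holomorphic closed embeddings onto `π⁻¹ b`), and
fibrewise constant equations `F_{ι b x} = F_b` (`F_b` homogeneous of degree `d ≥ m + 2` with
non-singular cone, `ψ ∘ ι b` into `V(F_b)`, `deg P = d − m − 2`). VERTICALITY at `y`: `u = dι_{π y}(u')`
for a vector `u'` of the fibre through `y`. Then any two local relative residue forms agree, at every
point `y` over `O` admissible for both, on every tuple of vertical vectors (`relResidue_agree_on_fibre`;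
the embedding is injective, so all vectors of the tuple are read at the same point of the fibre).
[cite: VoisinHodgeII2003, §6.1.1] [cite: Griffiths1969, §8] -/
theorem relResidue_agree_of_fibreEmbeddings (hψ : Continuous ψ) (hhol : HasHolomorphicCoords E ψ)
    {Ξ : Fin (m + 2) × Fin (m + 2) → MForm 𝓘(ℝ, E) T ℂ m}
    (hΞ : ∀ p y, Ξ p y = (show E [⋀^Fin m]→L[ℝ] ℂ from
      (residueFormula ψ (∑ s, c s y • G s) P p.1 p.2 y).restrictScalars ℝ))
    {U : Fin (m + 2) × Fin (m + 2) → Set T}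
    (hUadm : ∀ p, ∀ y ∈ U p, y ∈ liftDomain ψ p.1 ∧
      MvPolynomial.eval (projLift ψ p.1 y) (MvPolynomial.pderiv p.2 (∑ s, c s y • G s)) ≠ 0)
    {O : Set B} (hι : ∀ b ∈ O, IsFibreEmbedding EX E π b (ι b))
    (Fb : B → MvPolynomial (Fin (m + 2)) ℂ) {d : ℕ} (hFb : ∀ b ∈ O, (Fb b).IsHomogeneous d)
    (hjac : ∀ b ∈ O, ∀ z : Fin (m + 2) → ℂ, z ≠ 0 → MvPolynomial.eval z (Fb b) = 0 →
      ∃ j, MvPolynomial.eval z (MvPolynomial.pderiv j (Fb b)) ≠ 0)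
    (hFι : ∀ b ∈ O, ∀ x : Xf b, (∑ s, c s (ι b x) • G s) = Fb b)
    (hrange : ∀ b ∈ O, Set.range (ψ ∘ ι b) ⊆ projZeroLocus {Fb b})
    (hP : P.IsHomogeneous (d - (m + 2))) (hd : m + 2 ≤ d)
    (p q : Fin (m + 2) × Fin (m + 2)) {y : T} (hy : π y ∈ O) (hyp : y ∈ U p) (hyq : y ∈ U q)
    (w : Fin m → E)
    (hw : ∀ k, ∃ (x : Xf (π y)) (u' : EX), ι (π y) x = y ∧
      (show E from mfderiv 𝓘(ℝ, EX) 𝓘(ℝ, E) (ι (π y)) x u') = w k) :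
    Ξ p y w = Ξ q y w := by
  have hemb := hι (π y) hy
  -- the point of the fibre under `y`
  obtain ⟨x₀, hx₀⟩ : y ∈ Set.range (ι (π y)) := by
    rw [hemb.range_eq]; exact rfl
  -- all vectors of the tuple are read at `x₀`
  choose xs us hxs hus using hw
  have hxeq : ∀ k, xs k = x₀ := fun k ↦
    hemb.isClosedEmbedding.injective ((hxs k).trans hx₀.symm)
  have hw' : w = fun k ↦ (show E from mfderiv 𝓘(ℝ, EX) 𝓘(ℝ, E) (ι (π y)) x₀ (us k)) := by
    funext k
    rw [← hus k, hxeq k]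
  rw [hw']
  exact relResidue_agree_on_fibre ψ G c P hψ hhol hΞ hemb.isClosedEmbedding.continuous
    (hemb.contMDiff.mdifferentiable (by simp)) (hFb _ hy) (hjac _ hy) (hFι _ hy) (hrange _ hy) hP hd
    p q hx₀ (hUadm p y hyp) (hUadm q y hyq) us

/-- **The vertical `(1,0)`-condition of the glued relative residue form, for a family with fibre
identifications** (`mextDeriv_sum_smul_relResidue_cons_I_smul` with the agreement hypothesis
discharged by `relResidue_agree_of_fibreEmbeddings`): on `G' ∩ π⁻¹ O` (`G'` open with `Σ χ = 1`,
`O` open, `π` continuous), for every tuple `w` of vectors VERTICAL in the sense `w k = dι_{π y}(u'_k)`,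
`d(∑ χ p • Ξ p) y (i v, w) = i · d(∑ χ p • Ξ p) y (v, w)`. The kernel form of verticality
(`dπ_y (w k) = 0`) used by `PeriodsOfRelativeFormsHolomorphic` reduces to this one by the rank count
`ker dπ_y ⊆ im dι` of a fibre identification. [cite: VoisinHodgeI2002, §10.2.2 (proof of Thm. 10.9)]
[cite: Griffiths1969, §8] -/
theorem mextDeriv_sum_smul_relResidue_cons_I_smul_of_fibreEmbeddings (hψ : Continuous ψ)
    (hhol : HasHolomorphicCoords E ψ) (hc : ∀ s, MDifferentiable 𝓘(ℂ, E) 𝓘(ℂ, ℂ) (c s))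
    {Ξ : Fin (m + 2) × Fin (m + 2) → MForm 𝓘(ℝ, E) T ℂ m}
    (hΞ : ∀ p y, Ξ p y = (show E [⋀^Fin m]→L[ℝ] ℂ from
      (residueFormula ψ (∑ s, c s y • G s) P p.1 p.2 y).restrictScalars ℝ))
    {U : Fin (m + 2) × Fin (m + 2) → Set T}
    (hUadm : ∀ p, ∀ y ∈ U p, y ∈ liftDomain ψ p.1 ∧
      MvPolynomial.eval (projLift ψ p.1 y) (MvPolynomial.pderiv p.2 (∑ s, c s y • G s)) ≠ 0)
    {χ : Fin (m + 2) × Fin (m + 2) → T → ℝ} (hχ : ∀ p, ContMDiff 𝓘(ℝ, E) 𝓘(ℝ) ∞ (χ p))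
    (hsupp : ∀ p, tsupport (χ p) ⊆ U p)
    {G' : Set T} (hG' : IsOpen G') (hsum : ∀ y ∈ G', ∑ p, χ p y = 1)
    (hπ : Continuous π) {O : Set B} (hO : IsOpen O) (hι : ∀ b ∈ O, IsFibreEmbedding EX E π b (ι b))
    (Fb : B → MvPolynomial (Fin (m + 2)) ℂ) {d : ℕ} (hFb : ∀ b ∈ O, (Fb b).IsHomogeneous d)
    (hjac : ∀ b ∈ O, ∀ z : Fin (m + 2) → ℂ, z ≠ 0 → MvPolynomial.eval z (Fb b) = 0 →
      ∃ j, MvPolynomial.eval z (MvPolynomial.pderiv j (Fb b)) ≠ 0)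
    (hFι : ∀ b ∈ O, ∀ x : Xf b, (∑ s, c s (ι b x) • G s) = Fb b)
    (hrange : ∀ b ∈ O, Set.range (ψ ∘ ι b) ⊆ projZeroLocus {Fb b})
    (hP : P.IsHomogeneous (d - (m + 2))) (hd : m + 2 ≤ d)
    {y : T} (hyG : y ∈ G') (hyO : π y ∈ O) (v : E) (w : Fin m → E)
    (hw : ∀ k, ∃ (x : Xf (π y)) (u' : EX), ι (π y) x = y ∧
      (show E from mfderiv 𝓘(ℝ, EX) 𝓘(ℝ, E) (ι (π y)) x u') = w k) :
    (show E [⋀^Fin (m + 1)]→L[ℝ] ℂ from mextDeriv (∑ p, χ p • Ξ p) y) (Fin.cons (I • v) w) =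
      I * (show E [⋀^Fin (m + 1)]→L[ℝ] ℂ from mextDeriv (∑ p, χ p • Ξ p) y) (Fin.cons v w) := by
  refine mextDeriv_sum_smul_relResidue_cons_I_smul ψ G c P hψ hhol hc hΞ hUadm hχ hsupp
    (fun y u ↦ ∃ (x : Xf (π y)) (u' : EX), ι (π y) x = y ∧
      (show E from mfderiv 𝓘(ℝ, EX) 𝓘(ℝ, E) (ι (π y)) x u') = u)
    (G' := G' ∩ π ⁻¹' O) (hG'.inter (hO.preimage hπ)) (fun y hy ↦ hsum y hy.1) ?_ ⟨hyG, hyO⟩ v w hw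
  intro p q y hy hyp hyq w hw
  exact relResidue_agree_of_fibreEmbeddings ψ G c P π Xf ι hψ hhol hΞ hUadm hι Fb hFb hjac hFι hrange
    hP hd p q hy.2 hyp hyq w hw

end Family

/-! ### A smooth partition subordinate to the admissible charts near a compact set -/

omit [IsManifold 𝓘(ℂ, E) ω T] in
/-- **A smooth partition of unity subordinate to the admissible charts, `= 1` near a compact set.** If
every point of the compact `K ⊆ T` is admissible for some pair `(i, j)` (`y ∈ Tᵢ`, `∂_jF_y(Z̃ᵢ y) ≠ 0`;
for the total space of a family of smooth hypersurfaces: every point), there are an open `G' ⊇ K` and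
smooth `χ p ≥ 0` with `tsupport (χ p)` inside the `p`-admissible set (open,
`isOpen_setOf_eval_pderiv_ne_zero`) and `Σ_p χ p = 1` on `G'` (F-A `exists_smooth_partition_subordinate`
on the compact closure of an open between `K` and the union of the admissible sets).
[cite: WarnerGTM94, 1.11] [cite: VoisinHodgeII2003, §6.2.1] -/
theorem exists_partition_adapted_relResidue [T2Space T] [SigmaCompactSpace T] (hψ : Continuous ψ)
    (hhol : HasHolomorphicCoords E ψ) (hc : ∀ s, MDifferentiable 𝓘(ℂ, E) 𝓘(ℂ, ℂ) (c s))
    {K : Set T} (hK : IsCompact K)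
    (hcover : ∀ y ∈ K, ∃ p : Fin (m + 2) × Fin (m + 2), y ∈ liftDomain ψ p.1 ∧
      MvPolynomial.eval (projLift ψ p.1 y) (MvPolynomial.pderiv p.2 (∑ s, c s y • G s)) ≠ 0) :
    ∃ (G' : Set T) (χ : Fin (m + 2) × Fin (m + 2) → T → ℝ), IsOpen G' ∧ K ⊆ G' ∧
      (∀ p, ContMDiff 𝓘(ℝ, E) 𝓘(ℝ) ∞ (χ p)) ∧
      (∀ p, tsupport (χ p) ⊆ {y ∈ liftDomain ψ p.1 |
        MvPolynomial.eval (projLift ψ p.1 y) (MvPolynomial.pderiv p.2 (∑ s, c s y • G s)) ≠ 0}) ∧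
      (∀ p y, 0 ≤ χ p y) ∧ ∀ y ∈ G', ∑ p, χ p y = 1 := by
  haveI : FiniteDimensional ℝ E := FiniteDimensional.complexToReal E
  haveI : LocallyCompactSpace T := ChartedSpace.locallyCompactSpace E T
  set U : Fin (m + 2) × Fin (m + 2) → Set T := fun p ↦ {y ∈ liftDomain ψ p.1 |
    MvPolynomial.eval (projLift ψ p.1 y) (MvPolynomial.pderiv p.2 (∑ s, c s y • G s)) ≠ 0} with hU
  have hUo : ∀ p, IsOpen (U p) := fun p ↦ isOpen_setOf_eval_pderiv_ne_zero ψ hψ hhol G hc p.1 p.2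
  have hWo : IsOpen (⋃ p, U p) := isOpen_iUnion hUo
  have hKW : K ⊆ ⋃ p, U p := fun y hy ↦ by
    obtain ⟨p, hp⟩ := hcover y hy
    exact Set.mem_iUnion.2 ⟨p, hp⟩
  obtain ⟨V, hVo, hKV, hVW, -⟩ := exists_open_between_and_isCompact_closure hK hWo hKW
  obtain ⟨χ, hχs, hχsupp, hχ0, hχ1⟩ :=
    exists_smooth_partition_subordinate (ET := E) (T := T) isClosed_closure U hUo hVW
  exact ⟨V, χ, hVo, hKV, hχs, hχsupp, hχ0, fun y hy ↦ hχ1 y (subset_closure hy)⟩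

end Glue

end Literature.AlgebraicGeometry.HodgeTheory

end
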